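/-
Copyright (c) 2026 the pub-hodgecm-mathlib formalisation cell (harness21).  Prover seat hodgecm-mathlib-B-p14 (g33), 2026-09-01.  Road «W′» = «R1LL-WILD»
((W′-B6) sub-socket (B6-V) «value laws on the torus», owner B-p14 (g33)): THE WINDOW LAW AT ONE SHELL — Labesse–Langlands (2.1)–(2.2) for a torus element `T ∈ U_w` in
Eisenstein normal form and its partner `Ad(D_u) T`: the difference of the two shell averages is `(β, θ)_v` times the difference of the averages at two `β`-unit-free
WINDOW NORMAL FORMS, which are explicit matrices polynomial in `β` (continuous in the torus parameter, ★ B-p04 `continuousAt_descentForm_windowMatrix`).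
-/
import Literature.NumberTheory.Rogawski1990.RankOneUnstableWildWindowSign          -- ★ p844325 (this seat): `exists_normalForms_setIntegral_sub_eq_hilbertSymbol_mul` (the window sign at one shell)
import Literature.NumberTheory.Rogawski1990.RankOneKappaShellConjugateDescent       -- ★ p844379 (this seat): `descent_shellConjugate`, `coe_glDiagonal_pow_conj_regRep`
import Literature.NumberTheory.Rogawski1990.RankOneKappaOrbitalShellDressTorus       -- ★ p844241 (A-p13): `descent_conj_diagonal_eq` (the partner `Ad(D_u)` in descent coordinates)
import Literature.NumberTheory.Automorphic.UnitaryTwoDescentCongruenceDepth       -- ★ B-p10 (g27) (V-deep) FILE A: `eq_diagonal_inv_mul_mul_diagonal_of_descent` (`d X d⁻¹ = M ⇒ X = d⁻¹ M d`)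
import HarnessLib

/-!
# The window law at one shell: `F̄(X_m(T)) − F̄(X_m(Ad(D_u) T)) = (β, θ)_v · (F̄(X_A) − F̄(X_B))` with EXPLICIT window normal forms (road «W′», (B6-V), (V-win))

Topic `NumberTheory/Rogawski1990`; namespace `Literature.NumberTheory.Rogawski1990`.  THEOREMS ONLY (no definition, no instance, no notation, no named fact, no `sorry`); kernel
lane.  Cell `pub/hodgecm-mathlib`, crux H413 = stmt-HodgeConjecture-24833; road «W′» = «R1LL-WILD» (architect A-p16 (g28); (W′-B6) F0P3-p01 (g14) ★ fold p844200∕ED. 2 p844308,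
binder `hwin : ∀ t ∈ U, mfl ≤ N t → ∀ i ∈ Finset.range (j+R+1), fbar (oT t − j + i) ↑t − fbar (oT t − j + i) (e ↑t) = κT t * (Φ i t − ΦD i t)`; sub-socket (B6-V), owner B-p14 (g33),
census `B-provers/B-p14/g33/CENSUS-B6V-ValueLaws.B-p14g33.md`).
HONEST LABEL: HC_CM is proved only modulo the cell's 2 remaining named inputs (hLiu418, h413) until rung 0 closes; this file is `GL₂`-algebra over ★ lemmas; print cited for orientation.

THE MATHEMATICS [LabesseLanglands1979 §2 (2.1)–(2.2) pp. 8–9; Labesse2024 Th. 0.0.12].  Let `T ∈ U_w` have Eisenstein descent `d T d⁻¹ = ζ · ι(1 + β M_τ)`,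
`1 + β M_τ = (1, β v₀; β, 1 + β u₀)`, `ord_v β = o`, and let `T′ = D_u T D_u⁻¹` be its partner (`u = ι u_F`, `u_F` a unit with `(u_F, θ)_v = −1`).  At the shell `m` the conjugates
`X_m = r_m⁻¹ T r_m`, `Y_m = r_m⁻¹ T′ r_m` (`r_m = uη⁻¹ ^ m`, `uη = diag(η, σ̄η⁻¹)`, `ι c = η σ η` a uniformiser of `L⁺_v`) have descents `ζ · ι(S)`, `ζ · ι(D_{u_F} S D_{u_F}⁻¹)` with
`S = (1, β v₀ c^m; β c^{−m}, 1 + β u₀)` (★ `descent_shellConjugate`, ★ `descent_conj_diagonal_eq`; the diagonal `GL₂` elements commute).  The window sign (★ p844325) at the UNIT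
`β₁ := β c^{−o}` gives `X_A, X_B ∈ U_w` with descents `ζ · ι(D_{β₁}⁻¹ S D_{β₁})`, `ζ · ι(D_{β₁∕u_F}⁻¹ S D_{β₁∕u_F})` and `F̄(X_m) − F̄(Y_m) = (β₁, θ)_v (F̄(X_A) − F̄(X_B))`; here
`(β₁, θ)_v = (β, θ)_v` (`c^{−o} = N(η^{−o})` is a norm, ★ `hilbertSymbol_eq_one_of_toPlace_eq_mul_galAdicCompletionMap`), and for a window shell `m + j = o + i` the two normal
forms are the EXPLICIT matrices `A_i(β) = (1, v₀ c^i c^{−j} β²; c^j c^{−i}, 1 + β u₀)`, `B_i(β) = (1, v₀ c^i c^{−j} u_F⁻¹ β²; c^j c^{−i} u_F, 1 + β u₀)` — B-p04 (g35∕g36)'s window shape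
`(1, c₁ b²; c₂, 1 + b u₀)` with constants `c₁ c₂` (★ `continuousAt_windowMatrix`), value at `β = 0` the lower unipotent `(1, 0; c₂, 1)`.

* §1 bookkeeping: `conj_conj_eq_of_commute`, `commute_glDiagonal`, `det_ne_zero_of_descent`, `diagonal_inv_mul_mul_diagonal_two` (with ★ B-p10 `eq_diagonal_inv_mul_mul_diagonal_of_descent`).
* §2 **`exists_windowForms_setIntegral_shellConjugate_sub_eq_hilbertSymbol_mul`** (the window law at one shell, with the matrices of `X_A`, `X_B` spelled out).

## References
* [LabesseLanglands1979] J.-P. Labesse, R. P. Langlands, *L-indistinguishability for SL(2)*, Canad. J. Math. 31 (1979): §2 (2.1)–(2.2) pp. 8–9.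
* [Labesse2024StabilisationGermesSL2] J.-P. Labesse, *Stabilisation et germes pour SL(2)* (2024): Prop. 0.0.11, Th. 0.0.12.
* [Serre1980Trees] J.-P. Serre, *Trees* (1980): Ch. II §1.3 (the `GL₂` action in descent coordinates).
-/

set_option autoImplicit false

noncomputable section

open MeasureTheory Topology Set Function NumberField IsDedekindDomain ValuativeRel
open scoped MatrixGroups Matrix ValuativeRel

namespace Literature.NumberTheory.Rogawski1990

open Literature.NumberTheory.Automorphic Literature.NumberTheory.Automorphic.UnitaryGroup Literature.NumberTheory.GaloisRepresentations
  Literature.NumberTheory.Automorphic.HermitianLatticeTree Literature.NumberTheory.QuadraticForms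

/-! ## §1 Bookkeeping -/

section Bookkeeping

/-- In a group, if `P` and `Q` commute then `P⁻¹ (Q S Q⁻¹) P = Q (P⁻¹ S P) Q⁻¹`. [cite: Serre1980Trees, Ch. II §1.3] -/
theorem conj_conj_eq_of_commute {G : Type*} [Group G] {P Q : G} (h : Commute P Q) (S : G) :
    P⁻¹ * (Q * S * Q⁻¹) * P = Q * (P⁻¹ * S * P) * Q⁻¹ := by
  have h1 : P⁻¹ * Q = Q * P⁻¹ := h.inv_left.eq
  have h2 : Q⁻¹ * P = P * Q⁻¹ := h.inv_right.eq.symm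
  calc P⁻¹ * (Q * S * Q⁻¹) * P = (P⁻¹ * Q) * S * (Q⁻¹ * P) := by simp only [mul_assoc]
    _ = (Q * P⁻¹) * S * (P * Q⁻¹) := by rw [h1, h2]
    _ = Q * (P⁻¹ * S * P) * Q⁻¹ := by simp only [mul_assoc]

/-- Diagonal elements of `GL_n` commute. [cite: Serre1980Trees, Ch. II §1.3] -/
theorem commute_glDiagonal (n : ℕ) (F : Type*) [CommRing F] (a b : Fin n → Fˣ) : Commute (glDiagonal n F a) (glDiagonal n F b) := by
  rw [Commute, SemiconjBy, ← map_mul, ← map_mul, mul_comm]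

variable {F E : Type*} [Field F] [Field E] (ι : F →+* E) {α : E}

/-- The descended matrix of an invertible `X` is invertible: `d X d⁻¹ = s • ι(M)` ⇒ `det M ≠ 0`. [cite: Serre1980Trees, Ch. II §1.3] -/
theorem det_ne_zero_of_descent (hα0 : α ≠ 0) (X : GL (Fin 2) E) {s : E} {M : Matrix (Fin 2) (Fin 2) F}
    (h : Matrix.diagonal ![1, α] * (X : Matrix (Fin 2) (Fin 2) E) * Matrix.diagonal ![1, α⁻¹] = s • M.map ι) : M.det ≠ 0 := by
  intro hM
  have hX : (X : Matrix (Fin 2) (Fin 2) E).det ≠ 0 := by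
    rw [← Matrix.GeneralLinearGroup.val_det_apply]
    exact Units.ne_zero _
  have hmap : (M.map ι).det = ι M.det := by rw [RingHom.map_det, RingHom.mapMatrix_apply]
  have h1 := congrArg Matrix.det h
  rw [Matrix.det_mul, Matrix.det_mul, Matrix.det_smul, hmap, hM, map_zero, mul_zero] at h1
  simp [Matrix.det_diagonal, Fin.prod_univ_two, hα0, hX] at h1

/-- `diag(1, y)⁻¹ (p, q; r, s) diag(1, y) = (p, q y; y⁻¹ r, s)`. [cite: LabesseLanglands1979, §2 (2.1) p. 8] -/
theorem diagonal_inv_mul_mul_diagonal_two {y : F} (hy : y ≠ 0) (p q r s : F) :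
    Matrix.diagonal ![1, y⁻¹] * !![p, q; r, s] * Matrix.diagonal ![1, y] = !![p, q * y; y⁻¹ * r, s] := by
  ext i j
  fin_cases i <;> fin_cases j
  · simp [Matrix.mul_apply, Fin.sum_univ_two]
  · simp [Matrix.mul_apply, Fin.sum_univ_two]
  · simp [Matrix.mul_apply, Fin.sum_univ_two]
  · simp [Matrix.mul_apply, Fin.sum_univ_two]
    rw [mul_comm, ← mul_assoc, mul_inv_cancel₀ hy, one_mul]

end Bookkeeping

/-! ## §2 The window law at one shell -/

section Window

variable (L : Type) [Field L] [NumberField L] [IsCMField L] (v : HeightOneSpectrum (𝓞 ↥(maximalRealSubfield L)))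
  (w : PlacesOver L v) (hw : IsCMField.complexConj L • w.1 = w.1)

/-- Bookkeeping (private): `θ ≠ 0` in `L⁺_v`. [folklore] -/
private theorem theta_ne_zero_W :
    (algebraMap ↥(maximalRealSubfield L) (v.adicCompletion ↥(maximalRealSubfield L)) ((cmQuadraticGenerator L : 𝓞 ↥(maximalRealSubfield L)) : ↥(maximalRealSubfield L))) ≠ 0 := by
  rw [Ne, map_eq_zero_iff _ (algebraMap ↥(maximalRealSubfield L) (v.adicCompletion ↥(maximalRealSubfield L))).injective]
  exact fun h => not_isSquare_cmQuadraticGenerator L (by rw [h]; exact IsSquare.zero)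

omit [IsCMField L] in
/-- The matrix of `D_y := glDiagonal ![1, y]` (private bookkeeping). [folklore] -/
private theorem coe_glDiagonal_one_mk0_W {y : (v.adicCompletion ↥(maximalRealSubfield L))} (hy : y ≠ 0) :
    (((glDiagonal 2 (v.adicCompletion ↥(maximalRealSubfield L)) ![1, Units.mk0 (y) (hy)]) : GL (Fin 2) (v.adicCompletion ↥(maximalRealSubfield L))) : Matrix (Fin 2) (Fin 2) (v.adicCompletion ↥(maximalRealSubfield L))) = Matrix.diagonal ![1, y] := by
  rw [coe_glDiagonal]
  congr 1
  funext k
  fin_cases k <;> rfl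

omit [IsCMField L] in
/-- The matrix of `D_y⁻¹` (private bookkeeping). [folklore] -/
private theorem coe_glDiagonal_one_mk0_inv_W {y : (v.adicCompletion ↥(maximalRealSubfield L))} (hy : y ≠ 0) :
    ((((glDiagonal 2 (v.adicCompletion ↥(maximalRealSubfield L)) ![1, Units.mk0 (y) (hy)]))⁻¹ : GL (Fin 2) (v.adicCompletion ↥(maximalRealSubfield L))) : Matrix (Fin 2) (Fin 2) (v.adicCompletion ↥(maximalRealSubfield L))) = Matrix.diagonal ![1, y⁻¹] := by
  rw [← map_inv, coe_glDiagonal]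
  congr 1
  funext k
  fin_cases k <;> simp

variable {α : (w.1.adicCompletion L)} (hα : (galAdicCompletionMap (L := L) (IsCMField.complexConj L) hw) α = -α) (hα0 : α ≠ 0)
  {ϖF : (v.adicCompletion ↥(maximalRealSubfield L))} (hϖF : Valued.v ϖF = WithZero.exp (-1 : ℤ))
  (E₂ : (cmDatum L 2 (Matrix.of fun i j : Fin 2 => if i.val + j.val + 1 = 2 then (1 : L) else 0)).Local v ≃ₜ* ↥(unitaryGroupOfForm (galAdicCompletionMap (L := L) (IsCMField.complexConj L) hw) (placeForm (Matrix.of fun i j : Fin 2 => if i.val + j.val + 1 = 2 then (1 : L) else 0) w.1))) (K : Subgroup ((cmDatum L 2 (Matrix.of fun i j : Fin 2 => if i.val + j.val + 1 = 2 then (1 : L) else 0)).Local v)) (x₀ : {M : Submodule 𝒪[(v.adicCompletion ↥(maximalRealSubfield L))] (Fin 2 → (v.adicCompletion ↥(maximalRealSubfield L))) // IsSpecialLattice (RingHom.id _) ϖF !![(0 : (v.adicCompletion ↥(maximalRealSubfield L))), 1; -1, 0] M})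
  (hK : ∀ g, g ∈ K ↔ rhoVertexActPlace L v w hw hα hα0 hϖF (E₂ g) x₀ = x₀)
  [MeasurableSpace ((cmDatum L 2 (Matrix.of fun i j : Fin 2 => if i.val + j.val + 1 = 2 then (1 : L) else 0)).Local v × (cmDatum L 1 (Matrix.of fun i j : Fin 1 => if i.val + j.val + 1 = 1 then (1 : L) else 0)).Local v)] [BorelSpace ((cmDatum L 2 (Matrix.of fun i j : Fin 2 => if i.val + j.val + 1 = 2 then (1 : L) else 0)).Local v × (cmDatum L 1 (Matrix.of fun i j : Fin 1 => if i.val + j.val + 1 = 1 then (1 : L) else 0)).Local v)] (ν : Measure ((cmDatum L 2 (Matrix.of fun i j : Fin 2 => if i.val + j.val + 1 = 2 then (1 : L) else 0)).Local v × (cmDatum L 1 (Matrix.of fun i j : Fin 1 => if i.val + j.val + 1 = 1 then (1 : L) else 0)).Local v)) [ν.IsMulLeftInvariant]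

include hK in
/-- **THE WINDOW LAW AT ONE SHELL, EXPLICIT NORMAL FORMS** (Labesse–Langlands (2.1)–(2.2)).  `T ∈ U_w` with Eisenstein descent `ζ · ι(1, β v₀; β, 1 + β u₀)`, `ord_v β = o`;
its partner `T′ = D_u T D_u⁻¹` (`u = ι u_F`, `u_F` a unit with `(u_F, θ)_v = −1`); `uη = diag(η, σ̄η⁻¹)`, `ι c = η σ η`, `c` a uniformiser.  For a window shell `m + j = o + i`
there are `X_A, X_B ∈ U_w` WITH THE EXPLICIT MATRICES `d⁻¹ (ζ · ι A_i(β)) d`, `d⁻¹ (ζ · ι B_i(β)) d` (`A_i(β) = (1, v₀ c^i c^{−j} β²; c^j c^{−i}, 1 + β u₀)`,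
`B_i(β) = (1, v₀ c^i c^{−j} u_F⁻¹ β²; c^j c^{−i} u_F, 1 + β u₀)`) such that for every `f` and `a ∈ U(Φ₁)_v`
`F̄(r_m⁻¹ T r_m, a) − F̄(r_m⁻¹ T′ r_m, a) = (β, θ)_v · (F̄(X_A, a) − F̄(X_B, a))`, `r_m = uη⁻¹ ^ m`, `F̄(Z, a) = ∫_{K × U(Φ₁)_v} f(k⁻¹ (E₂⁻¹ Z, a) k) dν` — the `hwin` binder of
(W′-B6) at the shell `m = oT t − j + i`, with `κT t = (β, θ)_v`, `Φ i t = F̄(X_A, (↑t).2)`, `ΦD i t = F̄(X_B, (↑t).2)`.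
[cite: LabesseLanglands1979, §2 (2.1)–(2.2) pp. 8–9] [cite: Labesse2024StabilisationGermesSL2, Th. 0.0.12] -/
theorem exists_windowForms_setIntegral_shellConjugate_sub_eq_hilbertSymbol_mul [IsDiscreteValuationRing 𝒪[(v.adicCompletion ↥(maximalRealSubfield L))]]
    (hKo : IsOpen (((K.prod (⊤ : Subgroup ((cmDatum L 1 (Matrix.of fun i j : Fin 1 => if i.val + j.val + 1 = 1 then (1 : L) else 0)).Local v))) : Subgroup ((cmDatum L 2 (Matrix.of fun i j : Fin 2 => if i.val + j.val + 1 = 2 then (1 : L) else 0)).Local v × (cmDatum L 1 (Matrix.of fun i j : Fin 1 => if i.val + j.val + 1 = 1 then (1 : L) else 0)).Local v)) : Set ((cmDatum L 2 (Matrix.of fun i j : Fin 2 => if i.val + j.val + 1 = 2 then (1 : L) else 0)).Local v × (cmDatum L 1 (Matrix.of fun i j : Fin 1 => if i.val + j.val + 1 = 1 then (1 : L) else 0)).Local v))) (hx₀ : x₀.1 = latt (1 : Matrix (Fin 2) (Fin 2) (v.adicCompletion ↥(maximalRealSubfield L))))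
    {uF : (v.adicCompletion ↥(maximalRealSubfield L))} (huF0 : uF ≠ 0) (huF1 : valuation (v.adicCompletion ↥(maximalRealSubfield L)) uF = 1) (hu : hilbertSymbol (v.adicCompletion ↥(maximalRealSubfield L)) uF (algebraMap ↥(maximalRealSubfield L) (v.adicCompletion ↥(maximalRealSubfield L)) ((cmQuadraticGenerator L : 𝓞 ↥(maximalRealSubfield L)) : ↥(maximalRealSubfield L))) = -1)
    (u : ((w.1.adicCompletion L))ˣ) (huu : (u : (w.1.adicCompletion L)) = toPlace v w uF)
    (uη : ↥(unitaryGroupOfForm (galAdicCompletionMap (L := L) (IsCMField.complexConj L) hw) (placeForm (Matrix.of fun i j : Fin 2 => if i.val + j.val + 1 = 2 then (1 : L) else 0) w.1))) {η : (w.1.adicCompletion L)} (hη0 : η ≠ 0) (huη : ((uη : GL (Fin 2) (w.1.adicCompletion L)) : Matrix (Fin 2) (Fin 2) (w.1.adicCompletion L)) = Matrix.diagonal ![η, ((galAdicCompletionMap (L := L) (IsCMField.complexConj L) hw) η)⁻¹])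
    {c : (v.adicCompletion ↥(maximalRealSubfield L))} (hc0 : c ≠ 0) (hc : toPlace v w c = η * (galAdicCompletionMap (L := L) (IsCMField.complexConj L) hw) η) (hvc : Valued.v c = WithZero.exp (-1 : ℤ))
    (T T' : ↥(unitaryGroupOfForm (galAdicCompletionMap (L := L) (IsCMField.complexConj L) hw) (placeForm (Matrix.of fun i j : Fin 2 => if i.val + j.val + 1 = 2 then (1 : L) else 0) w.1))) {ζ : (w.1.adicCompletion L)} {β u₀ v₀ : (v.adicCompletion ↥(maximalRealSubfield L))}
    (hT : Matrix.diagonal ![1, α] * ((T : GL (Fin 2) (w.1.adicCompletion L)) : Matrix (Fin 2) (Fin 2) (w.1.adicCompletion L)) * Matrix.diagonal ![1, α⁻¹] = ζ • (!![(1 : (v.adicCompletion ↥(maximalRealSubfield L))), β * v₀; β, 1 + β * u₀]).map (toPlace v w))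
    (hT' : (T' : GL (Fin 2) (w.1.adicCompletion L)) = glDiagonal 2 (w.1.adicCompletion L) ![1, u] * (T : GL (Fin 2) (w.1.adicCompletion L)) * (glDiagonal 2 (w.1.adicCompletion L) ![1, u])⁻¹)
    {o : ℕ} (hβ : Valued.v β = WithZero.exp (-(o : ℤ))) {m i j : ℕ} (hm : m + j = o + i) :
    ∃ XA XB : ↥(unitaryGroupOfForm (galAdicCompletionMap (L := L) (IsCMField.complexConj L) hw) (placeForm (Matrix.of fun i j : Fin 2 => if i.val + j.val + 1 = 2 then (1 : L) else 0) w.1)),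
      ((XA : GL (Fin 2) (w.1.adicCompletion L)) : Matrix (Fin 2) (Fin 2) (w.1.adicCompletion L)) = Matrix.diagonal ![1, α⁻¹] * (ζ • (!![(1 : (v.adicCompletion ↥(maximalRealSubfield L))), v₀ * c ^ i * (c ^ j)⁻¹ * β ^ 2; c ^ j * (c ^ i)⁻¹, 1 + β * u₀]).map (toPlace v w)) * Matrix.diagonal ![1, α] ∧
      ((XB : GL (Fin 2) (w.1.adicCompletion L)) : Matrix (Fin 2) (Fin 2) (w.1.adicCompletion L)) = Matrix.diagonal ![1, α⁻¹] * (ζ • (!![(1 : (v.adicCompletion ↥(maximalRealSubfield L))), v₀ * c ^ i * (c ^ j)⁻¹ * uF⁻¹ * β ^ 2; c ^ j * (c ^ i)⁻¹ * uF, 1 + β * u₀]).map (toPlace v w)) * Matrix.diagonal ![1, α] ∧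
      ∀ (f : ((cmDatum L 2 (Matrix.of fun i j : Fin 2 => if i.val + j.val + 1 = 2 then (1 : L) else 0)).Local v × (cmDatum L 1 (Matrix.of fun i j : Fin 1 => if i.val + j.val + 1 = 1 then (1 : L) else 0)).Local v) → ℂ) (a : (cmDatum L 1 (Matrix.of fun i j : Fin 1 => if i.val + j.val + 1 = 1 then (1 : L) else 0)).Local v),
        (∫ k in (((K.prod (⊤ : Subgroup ((cmDatum L 1 (Matrix.of fun i j : Fin 1 => if i.val + j.val + 1 = 1 then (1 : L) else 0)).Local v))) : Subgroup ((cmDatum L 2 (Matrix.of fun i j : Fin 2 => if i.val + j.val + 1 = 2 then (1 : L) else 0)).Local v × (cmDatum L 1 (Matrix.of fun i j : Fin 1 => if i.val + j.val + 1 = 1 then (1 : L) else 0)).Local v)) : Set ((cmDatum L 2 (Matrix.of fun i j : Fin 2 => if i.val + j.val + 1 = 2 then (1 : L) else 0)).Local v × (cmDatum L 1 (Matrix.of fun i j : Fin 1 => if i.val + j.val + 1 = 1 then (1 : L) else 0)).Local v)), f (k⁻¹ * ((E₂.symm ((uη⁻¹ ^ m)⁻¹ * T * uη⁻¹ ^ m),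 a) : ((cmDatum L 2 (Matrix.of fun i j : Fin 2 => if i.val + j.val + 1 = 2 then (1 : L) else 0)).Local v × (cmDatum L 1 (Matrix.of fun i j : Fin 1 => if i.val + j.val + 1 = 1 then (1 : L) else 0)).Local v)) * k) ∂ν) - ∫ k in (((K.prod (⊤ : Subgroup ((cmDatum L 1 (Matrix.of fun i j : Fin 1 => if i.val + j.val + 1 = 1 then (1 : L) else 0)).Local v))) : Subgroup ((cmDatum L 2 (Matrix.of fun i j : Fin 2 => if i.val + j.val + 1 = 2 then (1 : L) else 0)).Local v × (cmDatum L 1 (Matrix.of fun i j : Fin 1 => if i.val + j.val + 1 = 1 then (1 : L) else 0)).Local v)) : Set ((cmDatum L 2 (Matrix.of fun i j : Fin 2 => if i.val + j.val + 1 = 2 then (1 : L) else 0)).Local v × (cmDatum L 1 (Matrix.of fun i j : Fin 1 => if i.val + j.val + 1 = 1 then (1 : L) else 0)).Local v)), f (k⁻¹ * ((E₂.symm ((uη⁻¹ ^ m)⁻¹ * T' * uη⁻¹ ^ m), a) : ((cmDatum L 2 (Matrix.of fun i j : Fin 2 => if i.val + j.val + 1 = 2 then (1 : L) else 0)).Local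 v × (cmDatum L 1 (Matrix.of fun i j : Fin 1 => if i.val + j.val + 1 = 1 then (1 : L) else 0)).Local v)) * k) ∂ν =
          ((hilbertSymbol (v.adicCompletion ↥(maximalRealSubfield L)) β (algebraMap ↥(maximalRealSubfield L) (v.adicCompletion ↥(maximalRealSubfield L)) ((cmQuadraticGenerator L : 𝓞 ↥(maximalRealSubfield L)) : ↥(maximalRealSubfield L))) : ℤ) : ℂ) * ((∫ k in (((K.prod (⊤ : Subgroup ((cmDatum L 1 (Matrix.of fun i j : Fin 1 => if i.val + j.val + 1 = 1 then (1 : L) else 0)).Local v))) : Subgroup ((cmDatum L 2 (Matrix.of fun i j : Fin 2 => if i.val + j.val + 1 = 2 then (1 : L) else 0)).Local v × (cmDatum L 1 (Matrix.of fun i j : Fin 1 => if i.val + j.val + 1 = 1 then (1 : L) else 0)).Local v)) : Set ((cmDatum L 2 (Matrix.of fun i j : Fin 2 => if i.val + j.val + 1 = 2 then (1 : L) else 0)).Local v × (cmDatum L 1 (Matrix.of fun i j : Fin 1 => if i.val + j.val + 1 = 1 then (1 : L) else 0)).Local v)), f (k⁻¹ * ((E₂.symm XA, a) : ((cmDatum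 L 2 (Matrix.of fun i j : Fin 2 => if i.val + j.val + 1 = 2 then (1 : L) else 0)).Local v × (cmDatum L 1 (Matrix.of fun i j : Fin 1 => if i.val + j.val + 1 = 1 then (1 : L) else 0)).Local v)) * k) ∂ν) - ∫ k in (((K.prod (⊤ : Subgroup ((cmDatum L 1 (Matrix.of fun i j : Fin 1 => if i.val + j.val + 1 = 1 then (1 : L) else 0)).Local v))) : Subgroup ((cmDatum L 2 (Matrix.of fun i j : Fin 2 => if i.val + j.val + 1 = 2 then (1 : L) else 0)).Local v × (cmDatum L 1 (Matrix.of fun i j : Fin 1 => if i.val + j.val + 1 = 1 then (1 : L) else 0)).Local v)) : Set ((cmDatum L 2 (Matrix.of fun i j : Fin 2 => if i.val + j.val + 1 = 2 then (1 : L) else 0)).Local v × (cmDatum L 1 (Matrix.of fun i j : Fin 1 => if i.val + j.val + 1 = 1 then (1 : L) else 0)).Local v)), f (k⁻¹ * ((E₂.symm XB, a) : ((cmDatum L 2 (Matrix.of fun i j : Fin 2 => if i.val + j.val + 1 = 2 then (1 : L) else 0)).Local v × (cmDatum L 1 (Matrix.of fun i j : Fin 1 => if i.val + j.val + 1 = 1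 then (1 : L) else 0)).Local v)) * k) ∂ν) := by
  have hθ0 := theta_ne_zero_W L v
  have hβ0 : β ≠ 0 := by
    intro h
    rw [h, map_zero] at hβ
    exact WithZero.exp_ne_zero hβ.symm
  -- the descended torus element as an element of `GL₂(L⁺_v)`
  have hdet : (!![(1 : (v.adicCompletion ↥(maximalRealSubfield L))), β * v₀; β, 1 + β * u₀]).det ≠ 0 := det_ne_zero_of_descent (toPlace v w) hα0 (T : GL (Fin 2) (w.1.adicCompletion L)) hT
  obtain ⟨γ, hγ⟩ : ∃ γ : GL (Fin 2) (v.adicCompletion ↥(maximalRealSubfield L)), ((γ : GL (Fin 2) (v.adicCompletion ↥(maximalRealSubfield L))) : Matrix (Fin 2) (Fin 2) (v.adicCompletion ↥(maximalRealSubfield L))) = !![(1 : (v.adicCompletion ↥(maximalRealSubfield L))), β * v₀; β, 1 + β * u₀] :=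
    ⟨Matrix.GeneralLinearGroup.mk'' _ (isUnit_iff_ne_zero.2 hdet), rfl⟩
  have hTγ : Matrix.diagonal ![1, α] * ((T : GL (Fin 2) (w.1.adicCompletion L)) : Matrix (Fin 2) (Fin 2) (w.1.adicCompletion L)) * Matrix.diagonal ![1, α⁻¹] = ζ • (((γ : GL (Fin 2) (v.adicCompletion ↥(maximalRealSubfield L))) : Matrix (Fin 2) (Fin 2) (v.adicCompletion ↥(maximalRealSubfield L)))).map (toPlace v w) := by rw [hγ]; exact hT
  -- the shell conjugate of `T`
  have hX := descent_shellConjugate L v w hw hα0 uη T hη0 huη hc0 hc m hTγ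
  -- the partner and its shell conjugate
  have hd1 : (((glDiagonal 2 (w.1.adicCompletion L) ![1, u]) : GL (Fin 2) (w.1.adicCompletion L)) : Matrix (Fin 2) (Fin 2) (w.1.adicCompletion L)) = Matrix.diagonal ![1, toPlace v w uF] := by
    rw [coe_glDiagonal]
    congr 1
    funext k
    fin_cases k <;> simp [huu]
  have hd2 : ((((glDiagonal 2 (w.1.adicCompletion L) ![1, u]))⁻¹ : GL (Fin 2) (w.1.adicCompletion L)) : Matrix (Fin 2) (Fin 2) (w.1.adicCompletion L)) = Matrix.diagonal ![1, (toPlace v w uF)⁻¹] := by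
    rw [← map_inv, coe_glDiagonal]
    congr 1
    funext k
    fin_cases k <;> simp [huu]
  have hT'mat : ((T' : GL (Fin 2) (w.1.adicCompletion L)) : Matrix (Fin 2) (Fin 2) (w.1.adicCompletion L)) = Matrix.diagonal ![1, toPlace v w uF] * ((T : GL (Fin 2) (w.1.adicCompletion L)) : Matrix (Fin 2) (Fin 2) (w.1.adicCompletion L)) * Matrix.diagonal ![1, (toPlace v w uF)⁻¹] := by
    rw [hT', Units.val_mul, Units.val_mul, hd1, hd2]
  have hT'desc : Matrix.diagonal ![1, α] * ((T' : GL (Fin 2) (w.1.adicCompletion L)) : Matrix (Fin 2) (Fin 2) (w.1.adicCompletion L)) * Matrix.diagonal ![1, α⁻¹] = ζ • ((((glDiagonal 2 (v.adicCompletion ↥(maximalRealSubfield L)) ![1, Units.mk0 (uF) (huF0)]) * γ * (glDiagonal 2 (v.adicCompletion ↥(maximalRealSubfield L)) ![1, Units.mk0 (uF) (huF0)])⁻¹ : GL (Fin 2) (v.adicCompletion ↥(maximalRealSubfield L))) : Matrix (Fin 2) (Fin 2) (v.adicCompletion ↥(maximalRealSubfield L)))).map (toPlace v w) := by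
    rw [hT'mat, descent_conj_diagonal_eq (toPlace v w) α uF hTγ, Units.val_mul, Units.val_mul, coe_glDiagonal_one_mk0_W L v huF0,
      coe_glDiagonal_one_mk0_inv_W L v huF0]
  have hY₀ := descent_shellConjugate L v w hw hα0 uη T' hη0 huη hc0 hc m hT'desc
  have hcomm : Commute ((glDiagonal 2 (v.adicCompletion ↥(maximalRealSubfield L)) ![1, Units.mk0 (c) (hc0)]) ^ m) (glDiagonal 2 (v.adicCompletion ↥(maximalRealSubfield L)) ![1, Units.mk0 (uF) (huF0)]) := (commute_glDiagonal 2 (v.adicCompletion ↥(maximalRealSubfield L)) _ _).pow_left m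
  rw [conj_conj_eq_of_commute hcomm] at hY₀
  -- the unit part `β₁ := β c^(-o)` of the window coordinate
  have hβ1ne : β * (c ^ o)⁻¹ ≠ 0 := mul_ne_zero hβ0 (inv_ne_zero (pow_ne_zero o hc0))
  have hβ1v : Valued.v (β * (c ^ o)⁻¹) = 1 := by
    rw [map_mul, map_inv₀, map_pow, hβ, hvc, ← WithZero.exp_nsmul, ← WithZero.exp_neg, ← WithZero.exp_add, smul_neg, nsmul_eq_mul, mul_one,
      neg_neg, neg_add_cancel, WithZero.exp_zero]
  have hβ1 : valuation (v.adicCompletion ↥(maximalRealSubfield L)) (β * (c ^ o)⁻¹) = 1 :=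
    (ValuativeRel.isEquiv (valuation (v.adicCompletion ↥(maximalRealSubfield L))) (Valued.v : Valuation (v.adicCompletion ↥(maximalRealSubfield L)) (WithZero (Multiplicative ℤ)))).eq_one_iff_eq_one.2 hβ1v
  -- THE WINDOW SIGN (★ p844325)
  obtain ⟨XA, XB, hXA, hXB, hF⟩ := exists_normalForms_setIntegral_sub_eq_hilbertSymbol_mul L v w hw hα hα0 hϖF E₂ K x₀ hK ν hKo hx₀ huF0 huF1 hu hβ1ne hβ1 _ _ hX hY₀
  -- the sign `(β₁, θ)_v = (β, θ)_v`: `c^(-o) = N(η^(-o))` is a norm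
  have hσpow : toPlace v w ((c ^ o)⁻¹) = (η ^ o)⁻¹ * (galAdicCompletionMap (L := L) (IsCMField.complexConj L) hw) ((η ^ o)⁻¹) := by
    rw [map_inv₀, map_pow, hc, mul_pow, mul_inv, map_inv₀, map_pow]
  have hκc := hilbertSymbol_eq_one_of_toPlace_eq_mul_galAdicCompletionMap L v w hw (inv_ne_zero (pow_ne_zero o hη0)) hσpow
  have hκ : hilbertSymbol (v.adicCompletion ↥(maximalRealSubfield L)) (β * (c ^ o)⁻¹) (algebraMap ↥(maximalRealSubfield L) (v.adicCompletion ↥(maximalRealSubfield L)) ((cmQuadraticGenerator L : 𝓞 ↥(maximalRealSubfield L)) : ↥(maximalRealSubfield L))) = hilbertSymbol (v.adicCompletion ↥(maximalRealSubfield L)) β (algebraMap ↥(maximalRealSubfield L) (v.adicCompletion ↥(maximalRealSubfield L)) ((cmQuadraticGenerator L : 𝓞 ↥(maximalRealSubfield L)) : ↥(maximalRealSubfield L))) := by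
    rw [hilbertSymbol_adicCompletion_mul_left (hx := hβ0) (hy := inv_ne_zero (pow_ne_zero o hc0)) (ha := hθ0), hκc, mul_one]
  -- the explicit matrices
  have hS : ((((glDiagonal 2 (v.adicCompletion ↥(maximalRealSubfield L)) ![1, Units.mk0 (c) (hc0)]) ^ m)⁻¹ * γ * (glDiagonal 2 (v.adicCompletion ↥(maximalRealSubfield L)) ![1, Units.mk0 (c) (hc0)]) ^ m : GL (Fin 2) (v.adicCompletion ↥(maximalRealSubfield L))) : Matrix (Fin 2) (Fin 2) (v.adicCompletion ↥(maximalRealSubfield L))) = !![(1 : (v.adicCompletion ↥(maximalRealSubfield L))), β * v₀ * c ^ m; β * (c ^ m)⁻¹, 1 + β * u₀] :=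
    coe_glDiagonal_pow_conj_regRep L v hc0 m u₀ v₀ 1 β hγ
  have hq1 : c ^ m / c ^ o = c ^ i / c ^ j :=
    (div_eq_div_iff (pow_ne_zero o hc0) (pow_ne_zero j hc0)).2 (by rw [← pow_add, ← pow_add, hm, add_comm])
  have hq2 : c ^ o / c ^ m = c ^ j / c ^ i :=
    (div_eq_div_iff (pow_ne_zero m hc0) (pow_ne_zero i hc0)).2 (by rw [← pow_add, ← pow_add, ← hm, add_comm])
  have e01 : β * v₀ * c ^ m * (β * (c ^ o)⁻¹) = v₀ * c ^ i * (c ^ j)⁻¹ * β ^ 2 := by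
    have h' : c ^ m * (c ^ o)⁻¹ = c ^ i * (c ^ j)⁻¹ := by rw [← div_eq_mul_inv, hq1, div_eq_mul_inv]
    calc β * v₀ * c ^ m * (β * (c ^ o)⁻¹) = v₀ * (c ^ m * (c ^ o)⁻¹) * β ^ 2 := by ring
      _ = v₀ * (c ^ i * (c ^ j)⁻¹) * β ^ 2 := by rw [h']
      _ = v₀ * c ^ i * (c ^ j)⁻¹ * β ^ 2 := by ring
  have e10 : (β * (c ^ o)⁻¹)⁻¹ * (β * (c ^ m)⁻¹) = c ^ j * (c ^ i)⁻¹ := by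
    have h' : c ^ o * (c ^ m)⁻¹ = c ^ j * (c ^ i)⁻¹ := by rw [← div_eq_mul_inv, hq2, div_eq_mul_inv]
    calc (β * (c ^ o)⁻¹)⁻¹ * (β * (c ^ m)⁻¹) = (β⁻¹ * β) * (c ^ o * (c ^ m)⁻¹) := by rw [mul_inv, inv_inv]; ring
      _ = c ^ j * (c ^ i)⁻¹ := by rw [inv_mul_cancel₀ hβ0, one_mul, h']
  have eB01 : β * v₀ * c ^ m * (β * (c ^ o)⁻¹ / uF) = v₀ * c ^ i * (c ^ j)⁻¹ * uF⁻¹ * β ^ 2 := by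
    rw [div_eq_mul_inv, ← mul_assoc (β * v₀ * c ^ m), e01]
    ring
  have eB10 : (β * (c ^ o)⁻¹ / uF)⁻¹ * (β * (c ^ m)⁻¹) = c ^ j * (c ^ i)⁻¹ * uF := by
    calc (β * (c ^ o)⁻¹ / uF)⁻¹ * (β * (c ^ m)⁻¹) = uF * ((β * (c ^ o)⁻¹)⁻¹ * (β * (c ^ m)⁻¹)) := by rw [div_eq_mul_inv, mul_inv, inv_inv]; ring
      _ = c ^ j * (c ^ i)⁻¹ * uF := by rw [e10]; ring
  have hA : ((((glDiagonal 2 (v.adicCompletion ↥(maximalRealSubfield L)) ![1, Units.mk0 (β * (c ^ o)⁻¹) (hβ1ne)]))⁻¹ * (((glDiagonal 2 (v.adicCompletion ↥(maximalRealSubfield L)) ![1, Units.mk0 (c) (hc0)]) ^ m)⁻¹ * γ * (glDiagonal 2 (v.adicCompletion ↥(maximalRealSubfield L)) ![1, Units.mk0 (c) (hc0)]) ^ m) * (glDiagonal 2 (v.adicCompletion ↥(maximalRealSubfield L)) ![1, Units.mk0 (β * (c ^ o)⁻¹) (hβ1ne)]) : GL (Fin 2) (v.adicCompletion ↥(maximalRealSubfield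 L))) : Matrix (Fin 2) (Fin 2) (v.adicCompletion ↥(maximalRealSubfield L))) =
      !![(1 : (v.adicCompletion ↥(maximalRealSubfield L))), v₀ * c ^ i * (c ^ j)⁻¹ * β ^ 2; c ^ j * (c ^ i)⁻¹, 1 + β * u₀] := by
    rw [Units.val_mul, Units.val_mul, coe_glDiagonal_one_mk0_inv_W L v hβ1ne, coe_glDiagonal_one_mk0_W L v hβ1ne, hS,
      diagonal_inv_mul_mul_diagonal_two hβ1ne, e01, e10]
  have hB : ((((glDiagonal 2 (v.adicCompletion ↥(maximalRealSubfield L)) ![1, Units.mk0 (β * (c ^ o)⁻¹ / uF) (div_ne_zero hβ1ne huF0)]))⁻¹ * (((glDiagonal 2 (v.adicCompletion ↥(maximalRealSubfield L)) ![1, Units.mk0 (c) (hc0)]) ^ m)⁻¹ * γ * (glDiagonal 2 (v.adicCompletion ↥(maximalRealSubfield L)) ![1, Units.mk0 (c) (hc0)]) ^ m) * (glDiagonal 2 (v.adicCompletion ↥(maximalRealSubfield L)) ![1, Units.mk0 (β * (c ^ o)⁻¹ / uF) (div_ne_zero hβ1ne huF0)]) : GL (Fin 2) (v.adicCompletion ↥(maximalRealSubfield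 L))) : Matrix (Fin 2) (Fin 2) (v.adicCompletion ↥(maximalRealSubfield L))) =
      !![(1 : (v.adicCompletion ↥(maximalRealSubfield L))), v₀ * c ^ i * (c ^ j)⁻¹ * uF⁻¹ * β ^ 2; c ^ j * (c ^ i)⁻¹ * uF, 1 + β * u₀] := by
    rw [Units.val_mul, Units.val_mul, coe_glDiagonal_one_mk0_inv_W L v (div_ne_zero hβ1ne huF0), coe_glDiagonal_one_mk0_W L v (div_ne_zero hβ1ne huF0), hS,
      diagonal_inv_mul_mul_diagonal_two (div_ne_zero hβ1ne huF0), eB01, eB10]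
  refine ⟨XA, XB, ?_, ?_, fun f a => ?_⟩
  · rw [eq_diagonal_inv_mul_mul_diagonal_of_descent hα0 hXA, hA]
  · rw [eq_diagonal_inv_mul_mul_diagonal_of_descent hα0 hXB, hB]
  · rw [hF f a, hκ]

end Window

end Literature.NumberTheory.Rogawski1990

end
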